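import Mathlib
import HarnessLib

/-!
# Galois tower induction along simple layers (arbitrary finite group)

`--supports` file for the crux `LiftDescend.AscentAutToGal` (stmt-Langlands-1061), registered stub
`stub_galoisTowerInduction` of its line `birth` — proved here verbatim — and, through the same theorem, the
glue of the reshaped line `registered` of the crux `BaseFieldAscent.AscentResidual` (stmt-Langlands-1095,
lead prover-line-stmt-Langlands-1095-0, 2026-08-17), where it is instantiated at
`P K := ∃ R : ReciprocityData K, ∀ n > 0, ∀ hcpt, GlobalLanglandsCorrespondenceGLn n K R hcpt`.

**Statement.** Let `P` be a property of number fields. If `P` climbs every Galois layer `L/K` of PRIME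
degree and every Galois layer whose group `Gal(L/K)` is SIMPLE and NOT solvable (non-abelian simple), then
`P` climbs every finite Galois extension `E/K` of number fields with `1 < [E:K]`
(`stub_galoisTowerInduction`); dually, if `P` descends every such layer it descends every finite Galois
`E/K` with `1 < [E:K]` (`galoisTowerDescent`, the same theorem applied to `¬ P`).

**Proof** (folklore; the solvable case — "a non-trivial finite solvable group has a normal subgroup of prime
index" — is the sorry-free pattern `AscentConjugationSolvableSplit.galois_prime_step` /
`recip_ascent_of_isSolvable` of `Cruxes/AscentConjugationSolvable/Split.lean`, generalised here from "normal
subgroup of prime index" to "maximal proper normal subgroup"):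
* `exists_maximal_normal` — a finite non-trivial group has a maximal proper normal subgroup `N` (the finite
  non-empty set of proper normal subgroups has a maximal element);
* `isSimpleGroup_quotient_of_maximal_normal` — then `G ⧸ N` is simple;
* `prime_card_of_isSimpleGroup_of_isSolvable` — a finite solvable simple group has prime order
  (`IsSimpleGroup.comm_iff_isSolvable`, `IsSimpleGroup.prime_card`);
* `galois_simple_step` — for `T/K` finite Galois with `1 < [T:K]`: `Gal(T/K)` is simple, or the fixed field
  `M = T^N` of a maximal proper normal `N ≠ 1` is Galois over `K` with simple group `G/N`
  (`IsGalois.of_fixedField_normal_subgroup`, `IsGalois.normalAutEquivQuotient`) and `1 < [T:M] = |N| < [T:K]`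
  (`IntermediateField.finrank_fixedField_eq_card`);
* strong induction on `[E:K]` over all base fields; a simple layer is prime (solvable case) or insoluble.
No layer of degree `1` is ever handed to the hypotheses, so nothing is transported along field isomorphisms.

References: folklore (composition series; e.g. D. J. S. Robinson, *A course in the theory of groups*, §3.1 and
5.4.8). No automorphic content.
-/

noncomputable section

-- `Summit.Langlands.Langlands.…` (summit = sub-problem name, D-0017 layout) trips `dupNamespace`
set_option linter.dupNamespace false

namespace Summit.Langlands.Langlands.Theorems.AscentAutToGal

/-! ## Group theory -/

/-- **A finite non-trivial group has a maximal proper normal subgroup**: some `N ◁ G` with `N ≠ ⊤` such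
that every normal subgroup containing `N` is `N` or `⊤` (a maximal element of the finite non-empty set of
proper normal subgroups, which contains `⊥`). [folklore] -/
theorem exists_maximal_normal (G : Type*) [Group G] [Finite G] [Nontrivial G] :
    ∃ N : Subgroup G, N.Normal ∧ N ≠ ⊤ ∧
      ∀ H : Subgroup G, H.Normal → N ≤ H → H = N ∨ H = ⊤ := by
  classical
  set S : Set (Subgroup G) := {H | H.Normal ∧ H ≠ ⊤} with hS
  have hfin : S.Finite := Set.toFinite S
  have hne : S.Nonempty := ⟨⊥, inferInstance, bot_ne_top⟩
  obtain ⟨N, hN⟩ := hfin.exists_maximal hne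
  refine ⟨N, hN.1.1, hN.1.2, fun H hH hle => ?_⟩
  by_cases hHtop : H = ⊤
  · exact Or.inr hHtop
  · exact Or.inl (hN.eq_of_ge ⟨hH, hHtop⟩ hle)

/-- **The quotient by a maximal proper normal subgroup is a simple group**: it is non-trivial as `N ≠ ⊤`,
and the preimage in `G` of a normal subgroup of `G ⧸ N` is normal and contains `N`, hence is `N` (the
subgroup is `⊥`) or `⊤` (the subgroup is `⊤`). [folklore] -/
theorem isSimpleGroup_quotient_of_maximal_normal {G : Type*} [Group G] (N : Subgroup G) [N.Normal]
    (hNtop : N ≠ ⊤) (hmax : ∀ H : Subgroup G, H.Normal → N ≤ H → H = N ∨ H = ⊤) :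
    IsSimpleGroup (G ⧸ N) := by
  haveI : Nontrivial (G ⧸ N) :=
    not_subsingleton_iff_nontrivial.mp fun h =>
      hNtop (QuotientGroup.subgroup_eq_top_of_subsingleton N h)
  refine ⟨fun H hH => ?_⟩
  have hc : (H.comap (QuotientGroup.mk' N)).Normal := Subgroup.normal_comap _
  rcases hmax _ hc (QuotientGroup.le_comap_mk' N H) with h | h
  · left
    rw [← Subgroup.map_comap_eq_self_of_surjective (QuotientGroup.mk'_surjective N) H, h,
      QuotientGroup.map_mk'_self]
  · right
    rwa [← Subgroup.comap_top (QuotientGroup.mk' N),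
      (Subgroup.comap_injective (QuotientGroup.mk'_surjective N)).eq_iff] at h

/-- **A finite solvable simple group has prime order**: a solvable simple group is commutative
(`IsSimpleGroup.comm_iff_isSolvable`), and a commutative simple group has prime order
(`IsSimpleGroup.prime_card`). [folklore] -/
theorem prime_card_of_isSimpleGroup_of_isSolvable (G : Type*) [Group G] [Finite G] [IsSimpleGroup G]
    [IsSolvable G] : (Nat.card G).Prime := by
  have hcomm : ∀ a b : G, a * b = b * a := IsSimpleGroup.comm_iff_isSolvable.mpr ‹_›
  letI : CommGroup G := { ‹Group G› with mul_comm := hcomm }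
  exact IsSimpleGroup.prime_card

/-! ## Galois theory: one step down a tower, arbitrary finite group -/

/-- **The Galois-theoretic step, arbitrary finite group.** For a finite Galois extension `T/K` of number
fields with `1 < [T:K]`: either `Gal(T/K)` is a simple group, or there is an intermediate field `M`, Galois
over `K` with SIMPLE group `Gal(M/K)`, such that `1 < [T:M] < [T:K]` (`M` is the fixed field of a maximal
proper normal subgroup `N ≠ 1` of `Gal(T/K)`, with `Gal(M/K) ≃ Gal(T/K) ⧸ N`; if `N = 1` the group itself is
simple). Generalises `AscentConjugationSolvableSplit.galois_prime_step` (solvable case). [folklore] -/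
theorem galois_simple_step (K T : Type) [Field K] [NumberField K] [Field T] [NumberField T] [Algebra K T]
    [IsGalois K T] (hlt : 1 < Module.finrank K T) :
    IsSimpleGroup (T ≃ₐ[K] T) ∨
      ∃ M : IntermediateField K T, IsGalois K M ∧ IsSimpleGroup (M ≃ₐ[K] M) ∧
        1 < Module.finrank M T ∧ Module.finrank M T < Module.finrank K T := by
  haveI : FiniteDimensional K T := Module.Finite.of_restrictScalars_finite ℚ K T
  have hcard : Nat.card (T ≃ₐ[K] T) = Module.finrank K T := IsGalois.card_aut_eq_finrank K T
  haveI : Nontrivial (T ≃ₐ[K] T) := by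
    rw [← Finite.one_lt_card_iff_nontrivial, hcard]; exact hlt
  obtain ⟨N, hN, hNtop, hmax⟩ := exists_maximal_normal (T ≃ₐ[K] T)
  haveI := hN
  haveI hsimple : IsSimpleGroup ((T ≃ₐ[K] T) ⧸ N) :=
    isSimpleGroup_quotient_of_maximal_normal N hNtop hmax
  by_cases hbot : N = ⊥
  · left
    subst hbot
    exact MulEquiv.isSimpleGroup (QuotientGroup.quotientBot (G := (T ≃ₐ[K] T))).symm
  · right
    have hEK : Module.finrank K (IntermediateField.fixedField N) = N.index := by
      rw [← IsGalois.card_aut_eq_finrank,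
        Nat.card_congr (IsGalois.normalAutEquivQuotient N).symm.toEquiv]
      rfl
    have hLE : Module.finrank (IntermediateField.fixedField N) T = Nat.card N :=
      IntermediateField.finrank_fixedField_eq_card N
    refine ⟨IntermediateField.fixedField N, IsGalois.of_fixedField_normal_subgroup N, ?_, ?_, ?_⟩
    · exact MulEquiv.isSimpleGroup (IsGalois.normalAutEquivQuotient N).symm
    · rw [hLE]
      exact (Subgroup.one_lt_card_iff_ne_bot N).mpr hbot
    · have hmul : N.index * Nat.card N = Module.finrank K T := by
        rw [← hEK, ← hLE, Module.finrank_mul_finrank]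
      have hidx : 1 < N.index := Subgroup.one_lt_index_of_ne_top hNtop
      rw [← hmul, hLE]
      calc Nat.card N = 1 * Nat.card N := (one_mul _).symm
        _ < N.index * Nat.card N := Nat.mul_lt_mul_of_pos_right hidx Nat.card_pos

/-! ## The tower induction -/

/-- **Galois tower induction along simple layers** — verbatim the registered stub `stub_galoisTowerInduction`
of the line `birth` of the crux `LiftDescend.AscentAutToGal` (stmt-Langlands-1061). For every predicate `P`
on number fields: if `P` climbs every Galois layer of PRIME degree and every Galois layer whose group is
SIMPLE and NOT solvable, then `P` climbs every finite Galois `E/K` with `1 < [E:K]`. Strong induction on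
`[E:K]` over all base fields through `galois_simple_step`: a simple `Gal(E/K)` is one layer — of prime
degree if solvable (`prime_card_of_isSimpleGroup_of_isSolvable`, `IsGalois.card_aut_eq_finrank`), insoluble
otherwise; else climb the simple layer `M/K` and recurse into `E/M`, of smaller degree `> 1`. No layer of
degree `1` is ever handed to the hypotheses (no transport of `P` along field isomorphisms). [folklore] -/
theorem stub_galoisTowerInduction :
    ∀ (P : (K : Type) → [Field K] → [NumberField K] → Prop),
      (∀ (K L : Type) [Field K] [NumberField K] [Field L] [NumberField L] [Algebra K L]
          [IsGalois K L], (Module.finrank K L).Prime → P K → P L) →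
      (∀ (K L : Type) [Field K] [NumberField K] [Field L] [NumberField L] [Algebra K L]
          [IsGalois K L], IsSimpleGroup (L ≃ₐ[K] L) → ¬ IsSolvable (L ≃ₐ[K] L) → P K → P L) →
      ∀ (K E : Type) [Field K] [NumberField K] [Field E] [NumberField E] [Algebra K E]
        [IsGalois K E], 1 < Module.finrank K E → P K → P E := by
  intro P hprime hsimple
  -- one simple layer: prime degree (solvable) or insoluble
  have hlayer : ∀ (K L : Type) [Field K] [NumberField K] [Field L] [NumberField L] [Algebra K L]
      [IsGalois K L], IsSimpleGroup (L ≃ₐ[K] L) → P K → P L := by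
    intro K L _ _ _ _ _ _ hs hK
    haveI : FiniteDimensional K L := Module.Finite.of_restrictScalars_finite ℚ K L
    haveI := hs
    by_cases hsolv : IsSolvable (L ≃ₐ[K] L)
    · have hp : (Module.finrank K L).Prime := by
        rw [← IsGalois.card_aut_eq_finrank]
        exact prime_card_of_isSimpleGroup_of_isSolvable (L ≃ₐ[K] L)
      exact hprime K L hp hK
    · exact hsimple K L hs hsolv hK
  -- strong induction on the degree, over all base fields
  suffices h : ∀ (d : ℕ) (K E : Type) [Field K] [NumberField K] [Field E] [NumberField E] [Algebra K E]
      [IsGalois K E], Module.finrank K E = d → 1 < d → P K → P E from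
    fun K E _ _ _ _ _ _ hlt hK => h _ K E rfl hlt hK
  intro d
  induction d using Nat.strong_induction_on with
  | _ d ih =>
    intro K E _ _ _ _ _ _ hd hlt hK
    rcases galois_simple_step K E (hd ▸ hlt) with hs | ⟨M, hGal, hsM, h1, hltM⟩
    · exact hlayer K E hs hK
    · haveI := hGal
      haveI : FiniteDimensional K E := Module.Finite.of_restrictScalars_finite ℚ K E
      haveI : NumberField M := NumberField.of_module_finite K M
      exact ih (Module.finrank M E) (hd ▸ hltM) M E rfl h1 (hlayer K M hsM hK)

/-- **Galois tower DESCENT along simple layers** (the dual form, for the descent halves of the cruxes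
`AscentAutToGal` / `AscentResidual`): if `P` descends every Galois layer of prime degree and every Galois
layer with simple insoluble group, then `P` descends every finite Galois `E/K` with `1 < [E:K]`. This is
`stub_galoisTowerInduction` applied to the predicate `¬ P` (contraposition layer by layer). [folklore] -/
theorem galoisTowerDescent (P : (K : Type) → [Field K] → [NumberField K] → Prop)
    (hprime : ∀ (K L : Type) [Field K] [NumberField K] [Field L] [NumberField L] [Algebra K L]
        [IsGalois K L], (Module.finrank K L).Prime → P L → P K)
    (hsimple : ∀ (K L : Type) [Field K] [NumberField K] [Field L] [NumberField L] [Algebra K L]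
        [IsGalois K L], IsSimpleGroup (L ≃ₐ[K] L) → ¬ IsSolvable (L ≃ₐ[K] L) → P L → P K)
    (K E : Type) [Field K] [NumberField K] [Field E] [NumberField E] [Algebra K E] [IsGalois K E]
    (hlt : 1 < Module.finrank K E) (hE : P E) : P K := by
  by_contra hK
  exact stub_galoisTowerInduction (fun K _ _ => ¬ P K)
    (fun K L _ _ _ _ _ _ hp hnK hL => hnK (hprime K L hp hL))
    (fun K L _ _ _ _ _ _ hs hns hnK hL => hnK (hsimple K L hs hns hL)) K E hlt hK hE

end Summit.Langlands.Langlands.Theorems.AscentAutToGal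

end
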